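import Literature.Algebra.Homology.TraceHomologyShortComplex
import Mathlib.LinearAlgebra.Charpoly.ToMatrix
import HarnessLib

/-!
# Characteristic polynomials along an endomorphism of a short complex of vector spaces (LEAF 1 of the charpoly twin)

Layer `Literature/Algebra/Homology` (pure linear algebra over Mathlib; proved theorems only, 0 definitions, 0 named facts, no
instances, no notation). Row `TraceHomologyShortComplex` splits the TRACE of the middle endomorphism `ψ.τ₂` of a short complex
`S : X₁ —f→ X₂ —g→ X₃` of vector spaces (`X₂` finite-dimensional, `ψ : S ⟶ S`); this file is its MULTIPLICATIVE twin for the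
CHARACTERISTIC POLYNOMIAL (Bourbaki, *Algèbre* VIII §20 n°6, p. 377: "si `0 → E' → E → E'' → 0` est une suite exacte …
`χ_E(a;T) = χ_{E'}(a;T) χ_{E''}(a;T)`"; Lang, *Algebra* XX §3: the characteristic polynomial is an Euler–Poincaré map):

* the conjugacies behind row `TraceHomologyShortComplex` as identities of linear maps: `conj_mapQ_ker_g_eq` (`X₂ ⁄ ker g ≅ range g`
  carries `ψ.τ₂ mod ker g` to `ψ.τ₃ | range g`), `conj_restrict_range_toCycles_eq` (`range(X₁ → ker g) ≅ range f` carries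
  `ψ.τ₂|_{ker g} | range(X₁ → ker g)` to `ψ.τ₂ | range f`), `homologyMap_comp_moduleCatHomologyIso_hom` (Mathlib's
  `moduleCatHomologyIso : H(S) ≅ ker g ⁄ range(X₁ → ker g)` carries `H(ψ)` to `ψ.τ₂|_{ker g} mod range(X₁ → ker g)`, a square in `ModuleCat K`);
* their characteristic-polynomial shadows (Mathlib `LinearEquiv.charpoly_conj`) and `moduleFinite_shortComplexHomology`;
* **`charpoly_τ₂_eq : χ(ψ.τ₂) = χ(H(ψ)) · χ(ψ.τ₃ | range g) · χ(ψ.τ₂ | range f)`** in `K[X]` — TWO applications, BY NAME, of the tree's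
  factorisation along an invariant subspace `Literature.RepresentationTheory.Semisimple.LinearMap.charpoly_eq_charpoly_restrict_mul_charpoly_mapQ`
  (`χ(u) = χ(u|_p) · χ(u mod p)`, file `RepresentationTheory/Semisimple/CharpolySubquotient`; not re-derived), on `ker g ⊆ X₂` and on
  `range(X₁ → ker g) ⊆ ker g`.

Row `TraceHomologyShortComplex`'s `trace_τ₂_eq` is the `nextCoeff` of this identity and row `EulerPoincareFormula`'s count its `natDegree`;
neither is restated or re-derived here. LEAF 2 (`CharpolyEulerPoincare`) multiplies it over a complex.
Library only (cell `pub-hodge-ring2`, count-neutral); proves nothing about any crux, route or conjecture.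

## References

* N. Bourbaki, *Algèbre, Chapitre VIII* (2012), §20 n°6, p. 377 (multiplicativity of `χ_E(a;T)` in exact sequences). [BourbakiAlgebreVIII2012]
* S. Lang, *Algebra* (2002), Ch. XX §3 (Euler–Poincaré maps), Ch. XIV §3 (characteristic polynomials). [Lang2002]
* A. Hatcher, *Algebraic Topology* (2002), §2.C, proof of Thm. 2C.3 (the subspace bookkeeping `Cₙ ⊇ Zₙ ⊇ Bₙ`). [HatcherAT2002]
-/

open CategoryTheory CategoryTheory.Limits

universe v u

namespace Literature.Algebra.Homology.HopfTrace

variable {K : Type u} [Field K] (S : ShortComplex (ModuleCat.{v} K)) (ψ : S ⟶ S)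

/-! ### The three conjugacies as identities of linear maps -/

/-- **`X₂ ⁄ ker g ≅ range g` conjugates `ψ.τ₂ mod ker g` to `ψ.τ₃ | range g`** (Mathlib's `LinearMap.quotKerEquivRange`).
[cite: HatcherAT2002, Thm. 2C.3 (proof)] -/
theorem conj_mapQ_ker_g_eq :
    S.g.hom.quotKerEquivRange.conj ((LinearMap.ker S.g.hom).mapQ (LinearMap.ker S.g.hom) ψ.τ₂.hom (mapsTo_ker_g S ψ)) =
      ψ.τ₃.hom.restrict (mapsTo_range_g S ψ) := by
  refine LinearMap.ext fun y => ?_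
  obtain ⟨x, hx⟩ := y.2
  have hy : y = ⟨S.g.hom x, ⟨x, rfl⟩⟩ := Subtype.ext hx.symm
  subst hy
  rw [LinearEquiv.conj_apply_apply, LinearMap.quotKerEquivRange_symm_apply_image, Submodule.mkQ_apply, Submodule.mapQ_apply]
  apply Subtype.ext
  rw [LinearMap.quotKerEquivRange_apply_mk, LinearMap.coe_restrict_apply]
  exact g_τ₂_apply S ψ x

/-- **`range(X₁ → ker g) ≅ range f` conjugates `ψ.τ₂|_{ker g} | range(X₁ → ker g)` to `ψ.τ₂ | range f`** (the equivalence does not move the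
underlying vector of `X₂`). [cite: HatcherAT2002, Thm. 2C.3 (proof)] -/
theorem conj_restrict_range_toCycles_eq :
    ((Submodule.equivMapOfInjective _ (LinearMap.ker S.g.hom).injective_subtype _).trans
        (LinearEquiv.ofEq _ _ (map_subtype_range_moduleCatToCycles S))).conj
      ((ψ.τ₂.hom.restrict (mapsTo_ker_g S ψ)).restrict (mapsTo_range_moduleCatToCycles S ψ)) =
      ψ.τ₂.hom.restrict (mapsTo_range_f S ψ) := by
  set e := (Submodule.equivMapOfInjective _ (LinearMap.ker S.g.hom).injective_subtype _).trans
    (LinearEquiv.ofEq _ _ (map_subtype_range_moduleCatToCycles S))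
  have hcoe : ∀ r : LinearMap.range S.moduleCatToCycles,
      ((e r : LinearMap.range S.f.hom) : S.X₂) = ((r : LinearMap.ker S.g.hom) : S.X₂) := fun r => rfl
  refine LinearMap.ext fun y => Subtype.ext ?_
  have h2 : ((e (e.symm y) : LinearMap.range S.f.hom) : S.X₂) = (y : S.X₂) := by rw [LinearEquiv.apply_symm_apply]
  calc ((e.conj ((ψ.τ₂.hom.restrict (mapsTo_ker_g S ψ)).restrict (mapsTo_range_moduleCatToCycles S ψ)) y : _) : S.X₂)
      = ψ.τ₂.hom (((e.symm y : LinearMap.range S.moduleCatToCycles) : LinearMap.ker S.g.hom) : S.X₂) := by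
        rw [LinearEquiv.conj_apply_apply, hcoe]; rfl
    _ = ψ.τ₂.hom (y : S.X₂) := by rw [← hcoe, h2]
    _ = ((ψ.τ₂.hom.restrict (mapsTo_range_f S ψ)) y : S.X₂) := rfl

/-- **Mathlib's `moduleCatHomologyIso : H(S) ≅ ker g ⁄ range(X₁ → ker g)` is equivariant**: it carries `H(ψ)` to
`ψ.τ₂|_{ker g} mod range(X₁ → ker g)` (checked after the surjection `homologyπ`). [cite: HatcherAT2002, Thm. 2C.3 (proof)] -/
theorem homologyMap_comp_moduleCatHomologyIso_hom :
    ShortComplex.homologyMap ψ ≫ S.moduleCatHomologyIso.hom =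
      S.moduleCatHomologyIso.hom ≫ ModuleCat.ofHom ((LinearMap.range S.moduleCatToCycles).mapQ (LinearMap.range S.moduleCatToCycles)
        (ψ.τ₂.hom.restrict (mapsTo_ker_g S ψ)) (fun x hx => mapsTo_range_moduleCatToCycles S ψ x hx)) := by
  rw [← cancel_epi S.homologyπ]
  ext z
  -- `iso (homologyπ w) = mk (cyclesIso w)`
  have hπ : ∀ w : S.cycles, S.moduleCatHomologyIso.hom.hom (S.homologyπ.hom w) =
      Submodule.Quotient.mk (S.moduleCatCyclesIso.hom.hom w) := by
    intro w
    have h := congrArg (fun φ => φ.hom w) S.π_moduleCatCyclesIso_hom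
    simp only [ModuleCat.hom_comp, LinearMap.comp_apply] at h
    exact h
  -- naturality of `homologyπ`
  have hnat : (ShortComplex.homologyMap ψ).hom (S.homologyπ.hom z) = S.homologyπ.hom ((ShortComplex.cyclesMap ψ).hom z) := by
    have h := congrArg (fun φ => φ.hom z) (ShortComplex.homologyπ_naturality ψ)
    simpa only [ModuleCat.hom_comp, LinearMap.comp_apply] using h
  -- `cyclesIso` intertwines `cyclesMap ψ` and `τ₂|_{ker g}` (compare the underlying vectors of `X₂`)
  have hi : ∀ w : S.cycles, S.moduleCatLeftHomologyData.i.hom (S.moduleCatCyclesIso.hom.hom w) = S.iCycles.hom w := by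
    intro w
    have h := congrArg (fun φ => φ.hom w) S.moduleCatCyclesIso_hom_i
    simpa only [ModuleCat.hom_comp, LinearMap.comp_apply] using h
  have hcyc : S.moduleCatCyclesIso.hom.hom ((ShortComplex.cyclesMap ψ).hom z) =
      ψ.τ₂.hom.restrict (mapsTo_ker_g S ψ) (S.moduleCatCyclesIso.hom.hom z) := by
    apply (LinearMap.ker S.g.hom).injective_subtype
    change S.moduleCatLeftHomologyData.i.hom _ = ψ.τ₂.hom (S.moduleCatLeftHomologyData.i.hom _)
    rw [hi, hi]
    have h := congrArg (fun φ => φ.hom z) (ShortComplex.cyclesMap_i ψ)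
    simpa only [ModuleCat.hom_comp, LinearMap.comp_apply] using h
  change S.moduleCatHomologyIso.hom.hom ((ShortComplex.homologyMap ψ).hom (S.homologyπ.hom z)) =
    (LinearMap.range S.moduleCatToCycles).mapQ (LinearMap.range S.moduleCatToCycles) (ψ.τ₂.hom.restrict (mapsTo_ker_g S ψ))
      (fun x hx => mapsTo_range_moduleCatToCycles S ψ x hx) (S.moduleCatHomologyIso.hom.hom (S.homologyπ.hom z))
  rw [hnat, hπ, hπ, hcyc]
  rfl

/-! ### Characteristic polynomials -/

/-- `H(S)` is finite-dimensional when `X₂` is (a subquotient). [cite: BourbakiAlgebreVIII2012, VIII §20 n°6 (p. 377)] -/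
theorem moduleFinite_shortComplexHomology [Module.Finite K S.X₂] : Module.Finite K S.homology :=
  haveI : Module.Finite K S.moduleCatLeftHomologyData.H :=
    inferInstanceAs (Module.Finite K (LinearMap.ker S.g.hom ⧸ LinearMap.range S.moduleCatToCycles))
  Module.Finite.equiv S.moduleCatHomologyIso.toLinearEquiv.symm

/-- **`χ(ψ.τ₂ mod ker g) = χ(ψ.τ₃ | range g)`**. [cite: BourbakiAlgebreVIII2012, VIII §20 n°6 (p. 377)] -/
theorem charpoly_mapQ_ker_g_eq [Module.Finite K S.X₂] :
    ((LinearMap.ker S.g.hom).mapQ (LinearMap.ker S.g.hom) ψ.τ₂.hom (mapsTo_ker_g S ψ)).charpoly =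
      (ψ.τ₃.hom.restrict (mapsTo_range_g S ψ)).charpoly := by
  rw [← conj_mapQ_ker_g_eq S ψ, LinearEquiv.charpoly_conj]

/-- **`χ(ψ.τ₂|_{ker g} | range(X₁ → ker g)) = χ(ψ.τ₂ | range f)`**. [cite: BourbakiAlgebreVIII2012, VIII §20 n°6 (p. 377)] -/
theorem charpoly_restrict_range_toCycles_eq [Module.Finite K S.X₂] :
    ((ψ.τ₂.hom.restrict (mapsTo_ker_g S ψ)).restrict (mapsTo_range_moduleCatToCycles S ψ)).charpoly =
      (ψ.τ₂.hom.restrict (mapsTo_range_f S ψ)).charpoly := by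
  rw [← conj_restrict_range_toCycles_eq S ψ, LinearEquiv.charpoly_conj]

/-- **`χ(ψ.τ₂|_{ker g} mod range(X₁ → ker g)) = χ(H(ψ))`**. [cite: BourbakiAlgebreVIII2012, VIII §20 n°6 (p. 377)] -/
theorem charpoly_homologyMap_eq [Module.Finite K S.X₂] [Module.Finite K S.homology] :
    ((LinearMap.range S.moduleCatToCycles).mapQ (LinearMap.range S.moduleCatToCycles)
        (ψ.τ₂.hom.restrict (mapsTo_ker_g S ψ)) (fun x hx => mapsTo_range_moduleCatToCycles S ψ x hx)).charpoly =
      (ShortComplex.homologyMap ψ).hom.charpoly := by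
  let e : S.homology ≃ₗ[K] (LinearMap.ker S.g.hom ⧸ LinearMap.range S.moduleCatToCycles) := S.moduleCatHomologyIso.toLinearEquiv
  have he : e.conj (ShortComplex.homologyMap ψ).hom = (LinearMap.range S.moduleCatToCycles).mapQ (LinearMap.range S.moduleCatToCycles)
      (ψ.τ₂.hom.restrict (mapsTo_ker_g S ψ)) (mapsTo_range_moduleCatToCycles S ψ) := by
    refine LinearMap.ext fun q => ?_
    obtain ⟨h, rfl⟩ := e.surjective q
    rw [LinearEquiv.conj_apply_apply, LinearEquiv.symm_apply_apply]
    have hsq := congrArg (fun χ => χ.hom h) (homologyMap_comp_moduleCatHomologyIso_hom S ψ)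
    simp only [ModuleCat.hom_comp, LinearMap.comp_apply] at hsq
    exact hsq
  rw [← he, LinearEquiv.charpoly_conj]

/-- **Characteristic polynomial of an endomorphism of a short complex**: `χ(ψ.τ₂) = χ(H(ψ)) · χ(ψ.τ₃ | range g) · χ(ψ.τ₂ | range f)`
(`X₂` finite-dimensional; the instance `Module.Finite K S.homology` is `moduleFinite_shortComplexHomology S`). Two applications of the tree's
`χ(u) = χ(u|_p) · χ(u mod p)` on `ker g ⊆ X₂` and `range(X₁ → ker g) ⊆ ker g`. Its `nextCoeff` is row `TraceHomologyShortComplex`'s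
`trace_τ₂_eq`, its `natDegree` row `EulerPoincareFormula`'s count (not restated).
[cite: BourbakiAlgebreVIII2012, VIII §20 n°6 (p. 377)] [cite: Lang2002, Ch. XX §3] -/
theorem charpoly_τ₂_eq [Module.Finite K S.X₂] [Module.Finite K S.homology] :
    ψ.τ₂.hom.charpoly =
      (ShortComplex.homologyMap ψ).hom.charpoly * (ψ.τ₃.hom.restrict (mapsTo_range_g S ψ)).charpoly *
        (ψ.τ₂.hom.restrict (mapsTo_range_f S ψ)).charpoly := by
  rw [Literature.RepresentationTheory.Semisimple.LinearMap.charpoly_eq_charpoly_restrict_mul_charpoly_mapQ ψ.τ₂.hom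
      (LinearMap.ker S.g.hom) (fun x hx => mapsTo_ker_g S ψ x hx),
    Literature.RepresentationTheory.Semisimple.LinearMap.charpoly_eq_charpoly_restrict_mul_charpoly_mapQ
      (ψ.τ₂.hom.restrict (mapsTo_ker_g S ψ)) (LinearMap.range S.moduleCatToCycles)
      (fun x hx => mapsTo_range_moduleCatToCycles S ψ x hx),
    charpoly_mapQ_ker_g_eq, charpoly_restrict_range_toCycles_eq, charpoly_homologyMap_eq]
  ring

end Literature.Algebra.Homology.HopfTrace
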